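import Summits.BirchSwinnertonDyer.BirchSwinnertonDyer.Theorems.ByReductionTypeAtTwoMultTowerSplitExactOddNonNorm
import Summits.BirchSwinnertonDyer.BirchSwinnertonDyer.Theorems.ByReductionTypeAtTwoMultTowerSplitExactLower
import Mathlib.Data.Fintype.Pigeonhole
import HarnessLib

/-!
# Route `ByReductionTypeAtTwo`, crux `MultUpperHalfAtTwo` (item stmt-BirchSwinnertonDyer-19922), TOWER road, SPLIT rows:
# the EXACT order of the local tower kernel at a split multiplicative prime, part 10 (ODD `p`) — the COUNT
# `#(M_∞/(g−1)M_∞)[p^∞] ≤ p^w` for a Tate unit of depth `w + 1`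

HONEST FRAMING (cell `bsd-2adic`, run/shared/lean/pub/bsd-2adic/, seat `bsd-2adic-tower-1` GEN 27, HUMAN RULINGS
D-0036 / D-0054 / D-0074): TOOL theorems only (no definition, no named fact, no `sorry`); closes nothing by itself;
nothing booked; BSD is not proved by any of this. Odd-`p` port of seat bsd-2adic-mult GEN 13's
`…MultTowerSplitOrderPrelims.lean` (pigeonhole) and `…MultTowerSplitOrderCount.lean` (the count), for the UPPER bound of the
`∀ p` named fact `hSP = Greenberg1999.sec3_natCard_localTowerKerPrimary_splitMultiplicative_rat`:

* `exists_ne_modEq_of_mem_addSubgroup_prime` — pigeonhole in a subgroup `S ≤ ℤ` containing `p^R`, `R = j + w + 1`, and no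
  `p^j a` (`p ∤ a`): among `N > p^w` elements of `S` two are congruent mod `p^R`;
* `finite_primaryComponent_coinvariants_and_card_le_odd` — **`(M_∞/(g−1)M_∞)[p^∞]` is finite of order `≤ p^w`** for the
  split Tate module at `v ∋ p` with Tate unit of depth `w + 1` (`‖1 − u^{p−1}‖ = p^{−(w+1)}`), verbatim the GEN 13 argument
  with `2 ↦ p`, `a odd ↦ p ∤ a`, the untwisted cyclic Hilbert 90 of `MultTowerSP1`, and part 9's non-norm lemma.

References: R. Greenberg, LNM 1716 §3 (pp. 85–93); J. Silverman, *Advanced Topics*, Thm. V.3.1, V.5.3; J. Neukirch,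
*Algebraic Number Theory*, Ch. IV (3.5), Ch. V §1 (1.1); cell memo NOTE-HNS2-KERNEL-GEN27.md (Stage D plan).
-/

set_option autoImplicit false
-- the Theorems namespace of this sub repeats the summit name by design (D-0017 nested layout: Summit.<S>.<Sub>)
set_option linter.dupNamespace false

noncomputable section

open scoped Classical

namespace Summit.BirchSwinnertonDyer.BirchSwinnertonDyer.Theorems.MultTowerSplitExact

open NumberField IsDedekindDomain Field WeierstrassCurve PadicInt Rat.HeightOneSpectrum
  Literature.NumberTheory.EllipticCurves Literature.NumberTheory.EllipticCurves.ResKernel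
  Literature.NumberTheory.GaloisRepresentations
  Summit.BirchSwinnertonDyer.BirchSwinnertonDyer.Theorems.MultTowerNS2

variable {p : ℕ} [hp : Fact p.Prime]

/-! ### Pigeonhole in a subgroup of `ℤ` -/

/-- **Pigeonhole in a subgroup of `ℤ`.** If `S ≤ ℤ` contains `p^R`, `R = j + w + 1`, and contains no `p^j · a` with
`p ∤ a`, then among `N > p^w` elements of `S` two are congruent mod `p^R` (`S = p^c ℤ` with `j < c ≤ R`). The `p`-general
form of GEN 13's `exists_ne_modEq_of_mem_addSubgroup`. [folklore] -/
theorem exists_ne_modEq_of_mem_addSubgroup_prime (S : AddSubgroup ℤ) {R j w : ℕ} (hR : R = j + w + 1)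
    (hmem : ((p : ℤ) ^ R) ∈ S) (hnot : ∀ a : ℕ, ¬ p ∣ a → ((p : ℤ) ^ j * a) ∉ S)
    {N : ℕ} (hN : p ^ w < N) (b : Fin N → ℤ) (hb : ∀ i, b i ∈ S) :
    ∃ i i' : Fin N, i ≠ i' ∧ b i ≡ b i' [ZMOD (p : ℤ) ^ R] := by
  obtain ⟨d, hd⟩ := Int.subgroup_cyclic S
  have hmemS : ∀ x : ℤ, x ∈ S ↔ (d.natAbs : ℤ) ∣ x := by
    intro x
    rw [hd, AddSubgroup.mem_closure_singleton, Int.natAbs_dvd]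
    constructor
    · rintro ⟨n, rfl⟩
      exact ⟨n, by rw [smul_eq_mul, mul_comm]⟩
    · rintro ⟨n, rfl⟩
      exact ⟨n, by rw [smul_eq_mul, mul_comm]⟩
  -- `|d| = p^c` with `j < c ≤ R`
  have hdvd : d.natAbs ∣ p ^ R := by
    have h := (hmemS _).mp hmem
    exact_mod_cast Int.natAbs_dvd_natAbs.mpr h
  obtain ⟨c, hcR, hc⟩ := (Nat.dvd_prime_pow hp.out).mp hdvd
  have hjc : j < c := by
    by_contra hle
    push Not at hle
    apply hnot 1 hp.out.not_dvd_one
    rw [hmemS, hc, Nat.cast_one, mul_one]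
    exact_mod_cast pow_dvd_pow p hle
  -- `b i = p^c * t i`
  have ht : ∀ i, ∃ t : ℤ, b i = (p : ℤ) ^ c * t := fun i ↦ by
    obtain ⟨t, ht⟩ := (hmemS _).mp (hb i)
    exact ⟨t, by rw [ht, hc]; push_cast; ring⟩
  choose t ht using ht
  -- pigeonhole on `t i mod p^(R - c)`
  have hcard : Fintype.card (ZMod (p ^ (R - c))) < Fintype.card (Fin N) := by
    rw [ZMod.card, Fintype.card_fin]
    calc p ^ (R - c) ≤ p ^ w := Nat.pow_le_pow_right hp.out.pos (by omega)
      _ < N := hN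
  obtain ⟨i, i', hii', h⟩ := Fintype.exists_ne_map_eq_of_card_lt (fun i ↦ (t i : ZMod (p ^ (R - c)))) hcard
  refine ⟨i, i', hii', ?_⟩
  have hmod : t i ≡ t i' [ZMOD ((p ^ (R - c) : ℕ) : ℤ)] := (ZMod.intCast_eq_intCast_iff _ _ _).mp h
  have h2 := Int.ModEq.mul_left' (c := (p : ℤ) ^ c) hmod
  rw [← ht, ← ht] at h2
  have hRc : (p : ℤ) ^ c * (((p ^ (R - c) : ℕ)) : ℤ) = (p : ℤ) ^ R := by
    push_cast
    rw [← pow_add, Nat.add_sub_cancel' hcR]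
  rwa [hRc] at h2

/-! ### The count: `#(M_∞/(g−1)M_∞)[p^∞] ≤ p^w` -/

variable {κ : ZpExtension ℚ p}

/-- **The `p`-power torsion of the coinvariants of the split Tate module has at most `p^w` elements (odd `p`).** Setting:
`κ` the cyclotomic `ℤ_p`-extension, `v ∋ p`, `Φ : K̄_vˣ ↠ E(K̄_v)` with kernel `q^ℤ` and `σ • Φ(u) = Φ(σu)` (BRICK S3),
`e : ℚ_v ≃ ℚ_p` a ring isomorphism with `e q = p^k u`, `‖1 − u^{p−1}‖ = p^{−(w+1)}` (depth `w + 1`), `g ∈ H_n` generating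
`H_n` topologically with `H_∞`, `M_∞ = E(K̄_v)^{H_∞}`. Then `(M_∞/(g−1)M_∞)[p^∞]` is finite of order `≤ p^w`: among any
`p^w + 1` classes two coincide (representatives at a common level `R = j + w + 1`, exponents `B` of `N_R(x) = Q^B` in the
subgroup `S ≤ ℤ` of admissible exponents — part 9's non-norm lemma excludes `p^j a`, `p ∤ a` —, pigeonhole
`exists_ne_modEq_of_mem_addSubgroup_prime`, cyclic Hilbert 90 `MultTowerSP1.exists_eq_smul_div_of_prod_smul_eq_one`).
The odd-`p` port of seat bsd-2adic-mult GEN 13's `MultTowerSplitOrder.finite_primaryComponent_coinvariants_and_card_le`.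
[cite: GreenbergLNM1716, §3 (pp. 85–93)] [cite: SilvermanATAEC1994, Thm. V.3.1 (c)(d), Thm. V.5.3]
[cite: NeukirchANT1999, Ch. IV (3.5) and Ch. V §1 Thm. (1.1)] -/
theorem finite_primaryComponent_coinvariants_and_card_le_odd (hp2 : p ≠ 2) (hκ : κ.IsCyclotomic)
    (v : HeightOneSpectrum (𝓞 ℚ)) (hv : ((p : ℕ) : 𝓞 ℚ) ∈ v.asIdeal) {W : WeierstrassCurve ℚ}
    {Φ : Additive (AlgebraicClosure (v.adicCompletion ℚ))ˣ →+ localPoints W (v.adicCompletion ℚ)}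
    {q : v.adicCompletion ℚ} (hsurj : Function.Surjective Φ)
    (hker : ∀ u : (AlgebraicClosure (v.adicCompletion ℚ))ˣ, Φ (Additive.ofMul u) = 0 ↔
      ∃ n : ℤ, (u : AlgebraicClosure (v.adicCompletion ℚ)) =
        algebraMap (v.adicCompletion ℚ) (AlgebraicClosure (v.adicCompletion ℚ)) q ^ n)
    (hequiv : ∀ (σ : absoluteGaloisGroup (v.adicCompletion ℚ)) (u u' : (AlgebraicClosure (v.adicCompletion ℚ))ˣ),
      (u' : AlgebraicClosure (v.adicCompletion ℚ)) = σ • (u : AlgebraicClosure (v.adicCompletion ℚ)) →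
        σ • Φ (Additive.ofMul u) = Φ (Additive.ofMul u'))
    (hq0 : q ≠ 0) (hq1 : ‖q‖ < 1)
    (e : v.adicCompletion ℚ ≃+* ℚ_[p]) {k : ℕ} {u : ℤ_[p]ˣ} (hq : e q = (p : ℚ_[p]) ^ k * ((u : ℤ_[p]) : ℚ_[p]))
    {w : ℕ} (hd : ‖1 - ((u : ℤ_[p]) : ℚ_[p]) ^ (p - 1)‖ = (p : ℝ) ^ (-((w : ℤ) + 1)))
    (n : ℕ) {g : absoluteGaloisGroup (v.adicCompletion ℚ)}
    (hgn : g ∈ localSubgroup (κ.layerSubgroup n) (v.adicCompletion ℚ))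
    (hgen : ∀ U : Subgroup (absoluteGaloisGroup (v.adicCompletion ℚ)),
      IsOpen (U : Set (absoluteGaloisGroup (v.adicCompletion ℚ))) →
        localSubgroup κ.kerSubgroup (v.adicCompletion ℚ) ≤ U → g ∈ U →
          localSubgroup (κ.layerSubgroup n) (v.adicCompletion ℚ) ≤ U) :
    Finite (AddCommGroup.primaryComponent
      (FixedPoints.addSubgroup (localSubgroup κ.kerSubgroup (v.adicCompletion ℚ)) (localPoints W (v.adicCompletion ℚ)) ⧸
        (subOne (localSubgroup κ.kerSubgroup (v.adicCompletion ℚ)) (localPoints W (v.adicCompletion ℚ)) g).range) p) ∧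
    Nat.card (AddCommGroup.primaryComponent
      (FixedPoints.addSubgroup (localSubgroup κ.kerSubgroup (v.adicCompletion ℚ)) (localPoints W (v.adicCompletion ℚ)) ⧸
        (subOne (localSubgroup κ.kerSubgroup (v.adicCompletion ℚ)) (localPoints W (v.adicCompletion ℚ)) g).range) p) ≤
      p ^ w := by
  -- notation and the layer subgroups
  set K := AlgebraicClosure (v.adicCompletion ℚ) with hK
  set Hi := localSubgroup κ.kerSubgroup (v.adicCompletion ℚ) with hHi
  have hile : ∀ m : ℕ, Hi ≤ localSubgroup (κ.layerSubgroup m) (v.adicCompletion ℚ) := fun m τ hτ ↦ by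
    rw [mem_localSubgroup_iff]
    rw [hHi, mem_localSubgroup_iff] at hτ
    exact κ.kerSubgroup_le_layerSubgroup m hτ
  have hanti : ∀ {m m' : ℕ}, m ≤ m' → localSubgroup (κ.layerSubgroup m') (v.adicCompletion ℚ) ≤
      localSubgroup (κ.layerSubgroup m) (v.adicCompletion ℚ) := fun h ↦ Subgroup.comap_mono (κ.layerSubgroup_antitone h)
  -- the Tate parameter in `K̄_v`
  set Q : K := algebraMap (v.adicCompletion ℚ) K q with hQ
  have hQ0 : Q ≠ 0 := by rw [hQ]; exact (map_ne_zero _).mpr hq0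
  have hQfix : ∀ σ : absoluteGaloisGroup (v.adicCompletion ℚ), σ • Q = Q := fun σ ↦
    AlgEquiv.commutes (absoluteGaloisGroup.toAlgEquiv _ σ) q
  have hQtor : ∀ j : ℤ, Q ^ j = 1 → j = 0 := by
    intro j hj
    have hj' : q ^ j = 1 := by
      apply (algebraMap (v.adicCompletion ℚ) K).injective
      rw [map_zpow₀, map_one]; exact hj
    have hpow : ∀ m : ℕ, q ^ m = 1 → m = 0 := fun m hm ↦ by
      by_contra hm0
      have h1 : ‖q‖ ^ m < 1 := pow_lt_one₀ (norm_nonneg q) hq1 hm0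
      rw [← norm_pow, hm, norm_one] at h1
      exact lt_irrefl _ h1
    cases j with
    | ofNat m =>
      rw [Int.ofNat_eq_natCast, zpow_natCast] at hj'
      rw [Int.ofNat_eq_natCast, hpow m hj']
      rfl
    | negSucc m =>
      rw [zpow_negSucc, inv_eq_one] at hj'
      exact absurd (hpow (m + 1) hj') (Nat.succ_ne_zero m)
  -- `κ(res g) = p^n · unit` (BRICK 15) and its consequences
  obtain ⟨ug, hug⟩ := MultTowerSP1.exists_units_kappa_resGal_eq_of_generate hκ v hv n hgn hgen
  have hd' : ‖1 - ((u : ℤ_[p]) : ℚ_[p]) ^ (p - 1)‖ = (p : ℝ) ^ (-(((w + 1 : ℕ)) : ℤ)) := by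
    rw [hd]; norm_cast
  have hgpow : ∀ R : ℕ, g ^ p ^ R ∈ localSubgroup (κ.layerSubgroup (n + R)) (v.adicCompletion ℚ) := fun R ↦
    (MultTowerSP1.pow_mem_localSubgroup_layerSubgroup_iff (κ := κ) v n R hug (p ^ R)).mpr dvd_rfl
  have hgiQ : ∀ i : ℕ, (g ^ i) • Q = Q := fun i ↦ hQfix _
  -- orbit products
  have hNQ : ∀ (R : ℕ) (c : ℤ), (∏ i ∈ Finset.range (p ^ R), (g ^ i) • (Q ^ c)) = Q ^ (c * (p : ℤ) ^ R) := by
    intro R c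
    rw [prod_smul_eq_pow_of_smul_eq g (p ^ R) (by rw [smul_zpow₀', hQfix]), ← zpow_natCast, ← zpow_mul,
      Nat.cast_pow]
  -- the coinvariants
  set P := localPoints W (v.adicCompletion ℚ) with hP
  set M : AddSubgroup P := FixedPoints.addSubgroup Hi P with hM
  have memM : ∀ {a : P}, a ∈ M ↔ ∀ h ∈ Hi, h • a = a := fun {a} ↦ by
    rw [hM, FixedPoints.mem_addSubgroup]
    exact ⟨fun H h hh ↦ H ⟨h, hh⟩, fun H h ↦ H h h.2⟩
  set d : M →+ M := subOne Hi P g with hd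
  set T := AddCommGroup.primaryComponent (M ⧸ d.range) p with hT
  -- (A) representatives: every class in `T` is `[Φ x]` with `x ∈ F_{n+R₀}`, `N_{R₀}(x) = Q^B`
  have hrep : ∀ y : T, ∃ (x : Kˣ) (m : M) (R₀ : ℕ) (B : ℤ),
      ((m : M ⧸ d.range) = (y : M ⧸ d.range)) ∧ (m : P) = Φ (Additive.ofMul x) ∧
      (∀ h ∈ localSubgroup (κ.layerSubgroup (n + R₀)) (v.adicCompletion ℚ), h • (x : K) = x) ∧
      (∏ i ∈ Finset.range (p ^ R₀), (g ^ i) • (x : K)) = Q ^ B := by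
    rintro ⟨y, hy⟩
    obtain ⟨a, ha⟩ := (AddCommGroup.mem_primaryComponent).mp hy
    obtain ⟨m, rfl⟩ := QuotientAddGroup.mk_surjective y
    obtain ⟨x, hxm, hxL⟩ := MultTowerSplitOrder.exists_unit_of_mem_fixedPoints_split (κ := κ) v hsurj hker hequiv hQfix
      hQ0 hQtor (memM.mp m.2)
    -- `p^a m ∈ (g-1) M_∞`
    have h2m : ((p ^ a) • m : M) ∈ d.range := by
      rw [← QuotientAddGroup.eq_zero_iff]
      exact ha
    obtain ⟨wM, hw⟩ := h2m
    obtain ⟨z, hzm, hzL⟩ := MultTowerSplitOrder.exists_unit_of_mem_fixedPoints_split (κ := κ) v hsurj hker hequiv hQfix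
      hQ0 hQtor (memM.mp wM.2)
    -- `Φ (x^{p^a}) = Φ (gz / z)`, so `x^{p^a} = Q^b · gz/z`
    set gz : Kˣ := Units.mk0 (g • (z : K)) ((smul_ne_zero_iff_ne g).mpr z.ne_zero) with hgz
    have hgΦ : g • Φ (Additive.ofMul z) = Φ (Additive.ofMul gz) := hequiv g z gz rfl
    have h3 : Φ (Additive.ofMul (x ^ p ^ a)) = Φ (Additive.ofMul (gz * z⁻¹)) := by
      rw [ofMul_pow, map_nsmul, hxm, ofMul_mul, ofMul_inv, map_add, map_neg, ← hgΦ, hzm, ← sub_eq_add_neg]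
      have h4 := congrArg (fun b : M ↦ (b : P)) hw
      simp only [hd, AddSubgroupClass.coe_nsmul] at h4
      exact h4.symm
    rw [tatePsi_eq_iff v hker] at h3
    obtain ⟨b, hb⟩ := h3
    rw [Units.val_pow_eq_pow_val, Units.val_mul, Units.val_inv_eq_inv_val, hgz, Units.val_mk0] at hb
    -- finite levels for `x` and `z`
    obtain ⟨m₁, hm₁⟩ := MultTowerSP1.exists_forall_mem_localSubgroup_layerSubgroup_smul_eq (κ := κ) v (x : K) hxL
    obtain ⟨m₂, hm₂⟩ := MultTowerSP1.exists_forall_mem_localSubgroup_layerSubgroup_smul_eq (κ := κ) v (z : K) hzL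
    set R₁ : ℕ := m₁ + m₂ with hR₁
    have hxR₁ : ∀ h ∈ localSubgroup (κ.layerSubgroup (n + R₁)) (v.adicCompletion ℚ), h • (x : K) = x :=
      fun h hh ↦ hm₁ h (hanti (by omega) hh)
    have hzR₁ : ∀ h ∈ localSubgroup (κ.layerSubgroup (n + R₁)) (v.adicCompletion ℚ), h • (z : K) = z :=
      fun h hh ↦ hm₂ h (hanti (by omega) hh)
    have hgx : (g ^ p ^ R₁) • (x : K) = x := hxR₁ _ (hgpow R₁)
    have hgzR : (g ^ p ^ R₁) • (z : K) = z := hzR₁ _ (hgpow R₁)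
    -- `N_{R₁}(x)^{p^a} = Q^{b p^{R₁}}`
    have hNz : (∏ i ∈ Finset.range (p ^ R₁), (g ^ i) • (z : K)) ≠ 0 :=
      Finset.prod_ne_zero_iff.mpr fun i _ ↦ (smul_ne_zero_iff_ne _).mpr z.ne_zero
    have hN1 : (∏ i ∈ Finset.range (p ^ R₁), (g ^ i) • (x : K)) ^ p ^ a = Q ^ (b * (p : ℤ) ^ R₁) := by
      calc (∏ i ∈ Finset.range (p ^ R₁), (g ^ i) • (x : K)) ^ p ^ a
          = ∏ i ∈ Finset.range (p ^ R₁), (g ^ i) • ((x : K) ^ p ^ a) := by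
            rw [← Finset.prod_pow]
            exact Finset.prod_congr rfl fun i _ ↦ (smul_pow' _ _ _).symm
        _ = ∏ i ∈ Finset.range (p ^ R₁), (g ^ i) • (Q ^ b * (g • (z : K) * (z : K)⁻¹)) := by rw [hb]
        _ = (∏ i ∈ Finset.range (p ^ R₁), (g ^ i) • (Q ^ b)) *
              ((∏ i ∈ Finset.range (p ^ R₁), (g ^ i) • (g • (z : K))) *
                ∏ i ∈ Finset.range (p ^ R₁), (g ^ i) • (z : K)⁻¹) := by rw [prod_smul_mul, prod_smul_mul]
        _ = Q ^ (b * (p : ℤ) ^ R₁) := by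
            rw [hNQ, prod_smul_smul_eq g (p ^ R₁) hgzR, prod_smul_inv, mul_inv_cancel₀ hNz, mul_one]
    -- one more raise by `a` levels: `N_{R₁+a}(x) = N_{R₁}(x)^{p^a}`
    refine ⟨x, m, R₁ + a, b * (p : ℤ) ^ R₁, rfl, hxm.symm, fun h hh ↦ hxR₁ h (hanti (by omega) hh), ?_⟩
    rw [prod_smul_prime_pow_add p g R₁ hgx a, hN1]
  -- (B) coincidence: equal exponents mod `p^R` at a common level give equal classes
  have hcoinc : ∀ (R : ℕ) (x₁ x₂ : Kˣ) (B₁ B₂ : ℤ),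
      (∀ h ∈ localSubgroup (κ.layerSubgroup (n + R)) (v.adicCompletion ℚ), h • (x₁ : K) = x₁) →
      (∀ h ∈ localSubgroup (κ.layerSubgroup (n + R)) (v.adicCompletion ℚ), h • (x₂ : K) = x₂) →
      (∏ i ∈ Finset.range (p ^ R), (g ^ i) • (x₁ : K)) = Q ^ B₁ →
      (∏ i ∈ Finset.range (p ^ R), (g ^ i) • (x₂ : K)) = Q ^ B₂ →
      B₁ ≡ B₂ [ZMOD (p : ℤ) ^ R] →
      ∃ mw : M, (d mw : P) = Φ (Additive.ofMul x₁) - Φ (Additive.ofMul x₂) := by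
    intro R x₁ x₂ B₁ B₂ hx₁ hx₂ hN₁ hN₂ hmod
    obtain ⟨c, hc⟩ := (Int.modEq_iff_dvd.mp hmod.symm)
    -- `uel = (x₁/x₂) · Q^{-c}` has orbit product `1`
    set uel : K := (x₁ : K) * (x₂ : K)⁻¹ * Q ^ (-c) with huel
    have hufix : ∀ h ∈ localSubgroup (κ.layerSubgroup (n + R)) (v.adicCompletion ℚ), h • uel = uel :=
      fun h hh ↦ by rw [huel, smul_mul', smul_mul', smul_inv'', hx₁ h hh, hx₂ h hh, smul_zpow₀', hQfix]
    have hN : (∏ i ∈ Finset.range (p ^ R), (g ^ i) • uel) = 1 := by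
      have h3 : ∀ i : ℕ, (g ^ i) • uel = (g ^ i) • (x₁ : K) * (g ^ i) • (x₂ : K)⁻¹ * (g ^ i) • (Q ^ (-c)) := fun i ↦ by
        rw [huel, smul_mul', smul_mul']
      rw [Finset.prod_congr rfl (fun i _ ↦ h3 i), Finset.prod_mul_distrib, Finset.prod_mul_distrib, hN₁, prod_smul_inv,
        hN₂, hNQ, ← zpow_neg, ← zpow_add₀ hQ0, ← zpow_add₀ hQ0]
      have hexp : B₁ + -B₂ + -c * (p : ℤ) ^ R = 0 := by linear_combination hc
      rw [hexp, zpow_zero]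
    obtain ⟨y, hy0, hyfix, hyu⟩ :=
      MultTowerSP1.exists_eq_smul_div_of_prod_smul_eq_one (κ := κ) v n R hug hufix hN
    -- `Φ y ∈ M_∞` and `Φ x₁ − Φ x₂ = (g − 1) Φ y`
    set yU : Kˣ := Units.mk0 y hy0 with hyU
    have hyM : Φ (Additive.ofMul yU) ∈ M :=
      memM.mpr (MultTowerSplitOrder.apply_mem_fixedPoints_split v hequiv Hi (x := yU)
        (fun h hh ↦ by rw [hyU, Units.val_mk0]; exact hyfix h (hile _ hh)))
    set gy : Kˣ := Units.mk0 (g • y) ((smul_ne_zero_iff_ne g).mpr hy0) with hgy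
    have hgΦ : g • Φ (Additive.ofMul yU) = Φ (Additive.ofMul gy) :=
      hequiv g yU gy (by rw [hgy, hyU, Units.val_mk0, Units.val_mk0])
    refine ⟨⟨Φ (Additive.ofMul yU), hyM⟩, ?_⟩
    have hdP : (d ⟨Φ (Additive.ofMul yU), hyM⟩ : P) = g • Φ (Additive.ofMul yU) - Φ (Additive.ofMul yU) := rfl
    rw [hdP, hgΦ]
    have e1 : Φ (Additive.ofMul x₁) - Φ (Additive.ofMul x₂) = Φ (Additive.ofMul (x₁ * x₂⁻¹)) := by
      rw [ofMul_mul, ofMul_inv, map_add, map_neg, sub_eq_add_neg]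
    have e2 : Φ (Additive.ofMul gy) - Φ (Additive.ofMul yU) = Φ (Additive.ofMul (gy * yU⁻¹)) := by
      rw [ofMul_mul, ofMul_inv, map_add, map_neg, sub_eq_add_neg]
    rw [e1, e2, tatePsi_eq_iff v hker]
    refine ⟨-c, ?_⟩
    rw [Units.val_mul, Units.val_inv_eq_inv_val, Units.val_mul, Units.val_inv_eq_inv_val, hgy, hyU, Units.val_mk0,
      Units.val_mk0]
    -- goal: `g • y * y⁻¹ = Q ^ (-c) * (x₁ * x₂⁻¹)`
    have hx12 : (x₁ : K) * (x₂ : K)⁻¹ = g • y / y * Q ^ c := by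
      rw [← hyu, huel, mul_assoc, ← zpow_add₀ hQ0, neg_add_cancel, zpow_zero, mul_one]
    rw [hx12, div_eq_mul_inv, mul_comm (g • y * y⁻¹) (Q ^ c), ← mul_assoc, ← zpow_add₀ hQ0, neg_add_cancel,
      zpow_zero, one_mul]
  -- (C) among `p^w + 1` classes two coincide
  have key : ∀ ys : Fin (p ^ w + 1) → T, ∃ i i' : Fin (p ^ w + 1), i ≠ i' ∧ ys i = ys i' := by
    intro ys
    choose x m R₀ B hmy hmx hxR hNx using fun i ↦ hrep (ys i)
    -- a common level `R = j + w + 1`, `j = ∑ R₀`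
    set j : ℕ := ∑ i, R₀ i with hj
    set R : ℕ := j + w + 1 with hR
    have hRi : ∀ i, R₀ i ≤ R := fun i ↦ by
      have : R₀ i ≤ j := by rw [hj]; exact Finset.single_le_sum (fun i _ ↦ Nat.zero_le _) (Finset.mem_univ i)
      omega
    have hxRR : ∀ i, ∀ h ∈ localSubgroup (κ.layerSubgroup (n + R)) (v.adicCompletion ℚ), h • (x i : K) = x i :=
      fun i h hh ↦ hxR i h (hanti (by linarith [hRi i]) hh)
    -- exponents at level `R`
    have hNR : ∀ i, ∃ B' : ℤ, (∏ i' ∈ Finset.range (p ^ R), (g ^ i') • (x i : K)) = Q ^ B' := by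
      intro i
      obtain ⟨t, ht⟩ := Nat.exists_eq_add_of_le (hRi i)
      refine ⟨B i * (p : ℤ) ^ t, ?_⟩
      rw [ht, prod_smul_prime_pow_add p g (R₀ i) (hxR i _ (hgpow (R₀ i))) t, hNx, ← zpow_natCast, ← zpow_mul,
        Nat.cast_pow]
    choose B' hB' using hNR
    -- the subgroup of admissible exponents
    let S : AddSubgroup ℤ :=
      { carrier := {c : ℤ | ∃ f : K, f ≠ 0 ∧
          (∀ h ∈ localSubgroup (κ.layerSubgroup (n + R)) (v.adicCompletion ℚ), h • f = f) ∧
          (∏ i ∈ Finset.range (p ^ R), (g ^ i) • f) = Q ^ c}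
        add_mem' := by
          rintro c₁ c₂ ⟨f₁, hf₁, hf₁R, hN₁⟩ ⟨f₂, hf₂, hf₂R, hN₂⟩
          refine ⟨f₁ * f₂, mul_ne_zero hf₁ hf₂, fun h hh ↦ by rw [smul_mul', hf₁R h hh, hf₂R h hh], ?_⟩
          rw [prod_smul_mul, hN₁, hN₂, zpow_add₀ hQ0]
        zero_mem' := ⟨1, one_ne_zero, fun h _ ↦ smul_one h, by
          rw [prod_smul_eq_pow_of_smul_eq g (p ^ R) (smul_one g), one_pow, zpow_zero]⟩
        neg_mem' := by
          rintro c ⟨f, hf, hfR, hN⟩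
          refine ⟨f⁻¹, inv_ne_zero hf, fun h hh ↦ by rw [smul_inv'', hfR h hh], ?_⟩
          rw [prod_smul_inv, hN, zpow_neg] }
    have hmemS : ((p : ℤ) ^ R) ∈ S := ⟨Q, hQ0, fun h _ ↦ hQfix h, by
      rw [prod_smul_eq_pow_of_smul_eq g (p ^ R) (hQfix g), ← zpow_natCast, Nat.cast_pow]⟩
    have hnotS : ∀ a : ℕ, ¬ p ∣ a → ((p : ℤ) ^ j * a) ∉ S := by
      rintro a ha ⟨f, hf, hfR, hN⟩
      have hne := prod_smul_ne_pow_of_depth_odd hp2 hκ v hv e hq hd' n hug ha (j := j) (R := R) (by omega) hfR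
      apply hne
      rw [hN, map_pow, ← zpow_natCast, Nat.cast_mul, Nat.cast_pow]
    have hBS : ∀ i, B' i ∈ S := fun i ↦ ⟨(x i : K), (x i).ne_zero, hxRR i, hB' i⟩
    obtain ⟨i, i', hii', hmodB⟩ :=
      exists_ne_modEq_of_mem_addSubgroup_prime S hR hmemS hnotS (Nat.lt_succ_self _) B' hBS
    refine ⟨i, i', hii', ?_⟩
    obtain ⟨mw, hmw⟩ := hcoinc R (x i) (x i') (B' i) (B' i') (hxRR i) (hxRR i') (hB' i) (hB' i') hmodB
    have hmm : (m i : M ⧸ d.range) = m i' := by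
      rw [QuotientAddGroup.eq_iff_sub_mem]
      refine ⟨mw, Subtype.ext ?_⟩
      rw [AddSubgroupClass.coe_sub, hmx, hmx]
      exact hmw
    exact Subtype.ext (by rw [← hmy i, ← hmy i', hmm])
  -- hence `T` is finite of order `≤ p^w`
  haveI hfin : Finite T := by
    by_contra hinf
    rw [not_finite_iff_infinite] at hinf
    let emb := Infinite.natEmbedding T
    obtain ⟨i, i', hii', h⟩ := key (fun i : Fin (p ^ w + 1) ↦ emb i)
    exact hii' (Fin.ext (emb.injective h))
  refine ⟨hfin, ?_⟩
  by_contra hlt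
  push Not at hlt
  letI := Fintype.ofFinite T
  rw [Nat.card_eq_fintype_card] at hlt
  let emb : Fin (p ^ w + 1) ↪ T := (Fin.castLEEmb hlt).trans (Fintype.equivFin _).symm.toEmbedding
  obtain ⟨i, i', hii', h⟩ := key emb
  exact hii' (emb.injective h)

end Summit.BirchSwinnertonDyer.BirchSwinnertonDyer.Theorems.MultTowerSplitExact

end
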